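import Literature.MathematicalPhysics.QuantumFieldTheory.Balaban1983to89.LatticeFieldCalculus
import Literature.MathematicalPhysics.QuantumFieldTheory.Balaban1983to89.T4Covariance
import HarnessLib

/-!
# Route `UnitScaleTilt`, crux K1 «MinimiserStabilityRegPr» (stmt-QuantumFields-19200), leaf V2′ `stub_halvingStep` — branch (P2-small) «H-SMALL», mechanism (α)
# COVERING ∕ PERIODISATION (★★OWNER RULING g26-№18): **brick α3a — THE LEVEL-0 STENCILS `∂` (gradient), `∂*` (divergence), curl, `Δ` (Laplacian) INTERTWINE WITH
# THE PULLBACK AND WITH THE PUSHFORWARD OF ANY LATTICE-GRAPH HOMOMORPHISM** (a map of sites commuting with `± e_μ`; e.g. the covering map `proj 0` of brick α1)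

Cell `ym3-torus` (HUMAN RULING D-0037, YM ladder rung R3 — continuum SU(2) YM₃ on the torus is a RUNG, not the Clay problem), width seat `ym-ust-19200-w5` gen 3
(LEAD (S3), H-SMALL planner).  `--supports stmt-QuantumFields-19200 --as helper`; def-free, 0 sorry, standard axioms.

SETTING.  Two lattices `P`, `P′` of the same dimension (`hd : P′.d = P.d`), a map `φ : Site P′ 0 → Site P 0` with `φ(x ± e_μ) = φ(x) ± e_μ` (directions read
through `Fin.cast hd`; NO injectivity or surjectivity assumed).  Pullbacks are compositions (`f ∘ φ`, `b′ ↦ A ⟨φ b′₋, b′.dir⟩`, …); pushforwards are FIBRE SUMS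
(`x ↦ Σ_{x′ : φ x′ = x} g x′`, …), written out.  Statements at the function level of ✓`LatticeFieldCalculus` (`grad`, `diverg`, `curl`, `laplace`); the `ℓ²`
wrappers `dE∕dsE∕dcE∕lapE` of `B6SectAOperatorsV1` unfold to these by `rfl`.
* §1 pullbacks: `grad_comp`, `diverg_comp`, `curl_comp`, `laplace_comp`.
* §2 the `ℓ²` adjointness of pullback and pushforward: `sum_comp_mul_eq_sum_mul_fibre` (any map of finite types).
* §3 pushforwards: `shift∕unshift_fibre_bijective` (fibres are `± e_μ`-equivariant), `bondFibre_src_bijective`, `pushBond_apply`, `grad_push`, `diverg_push`,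
  `laplace_push`, `plaqFibre_src_bijective`, `curl_push`.
With ✓`CoverFlatOps.adjoint_intertwine_of_push`∕`starProjection_intertwine_of_push` (α3-core) and ✓`CoverFlatOps.hOp_intertwine` (α4-core) these give the `∂*∂`
and `∂R∂*` summands of `Δ_a` on a cover; the `Q*aQ` summand needs α1∕α2's `projIdx` (α3b).  NOT a claim about the mass gap.

References: T. Bałaban, CMP **95** (1984) 17–40 [Balaban1984PropagatorsI] ((1.2)–(1.4) p.18, (1.21) p.21); CMP **96** (1984) 223–250 [Balaban1984PropagatorsII]
((2.5)–(2.8) p.224, (2.19) p.226).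
-/

noncomputable section

open scoped BigOperators Classical

namespace Summit.QuantumFields.YangMills.Theorems.CoverStencils

open Literature.MathematicalPhysics.QuantumFieldTheory.Balaban1983to89
open LatticeFieldCalculus (grad diverg curl laplace)

/-! ## §2 (stated first, it needs no lattice) Pullback and pushforward are `ℓ²`-adjoint -/

/-- **`Σ_{a} f(ψ a)·g(a) = Σ_b f(b)·Σ_{a : ψ a = b} g(a)`** for any map `ψ` of finite types (sites, bonds, plaquettes, index bonds alike).
[cite: Balaban1984PropagatorsII, (2.8) p.224] -/
theorem sum_comp_mul_eq_sum_mul_fibre {α β : Type*} [Fintype α] [Fintype β] (ψ : α → β) (f : β → ℝ) (g : α → ℝ) :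
    ∑ a, f (ψ a) * g a = ∑ b, f b * ∑ a : {a // ψ a = b}, g a := by
  rw [← Fintype.sum_fiberwise ψ (fun a => f (ψ a) * g a)]
  refine Finset.sum_congr rfl fun b _ => ?_
  rw [Finset.mul_sum]
  exact Finset.sum_congr rfl fun a _ => by rw [a.2]

variable {P P' : Params} (hd : P'.d = P.d) (φ : Site P' 0 → Site P 0)
  (hs : ∀ (x : Site P' 0) (μ : Fin P'.d), φ (x.shift μ) = (φ x).shift (Fin.cast hd μ))
  (hu : ∀ (x : Site P' 0) (μ : Fin P'.d), φ (x.unshift μ) = (φ x).unshift (Fin.cast hd μ))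

/-! ## §1 Pullbacks -/

include hs in
/-- `∂(f∘φ) = (∂f)∘φB`. [cite: Balaban1984PropagatorsI, (1.4) p.18] -/
theorem grad_comp (c : ℝ) (f : SiteField P 0 ℝ) (b' : PBond P' 0) :
    grad c (f ∘ φ) b' = grad c f ⟨φ b'.src, Fin.cast hd b'.dir⟩ := by
  simp only [grad, Function.comp_apply, PBond.tgt, hs]

include hu in
/-- `∂*(A∘φB) = (∂*A)∘φ`. [cite: Balaban1984PropagatorsI, (1.21) p.21] -/
theorem diverg_comp (c : ℝ) (A : VecField P 0 ℝ) (x' : Site P' 0) :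
    diverg c (fun b' : PBond P' 0 => A ⟨φ b'.src, Fin.cast hd b'.dir⟩) x' = diverg c A (φ x') := by
  simp only [diverg, hu]
  rw [← Equiv.sum_comp (finCongr hd)]
  simp only [finCongr_apply]

include hs in
/-- `curl(A∘φB) = (curl A)∘φP`. [cite: Balaban1984PropagatorsI, (1.2) p.18] -/
theorem curl_comp (c : ℝ) (A : VecField P 0 ℝ) (p' : Plaq P' 0) :
    curl c (fun b' : PBond P' 0 => A ⟨φ b'.src, Fin.cast hd b'.dir⟩) p' =
      curl c A ⟨φ p'.src, Fin.cast hd p'.μ, Fin.cast hd p'.ν, Fin.lt_def.mpr (Fin.lt_def.mp p'.hμν)⟩ := by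
  simp only [curl, hs]

include hs hu in
/-- `Δ(f∘φ) = (Δf)∘φ`. [cite: Balaban1984PropagatorsI, (1.21) p.21] -/
theorem laplace_comp (c : ℝ) (f : SiteField P 0 ℝ) (x' : Site P' 0) :
    laplace c (f ∘ φ) x' = laplace c f (φ x') := by
  simp only [laplace, Function.comp_apply, hs, hu]
  rw [← Equiv.sum_comp (finCongr hd)]
  simp only [finCongr_apply]

/-! ## §3 Pushforwards -/

include hs hu in
/-- **FIBRES ARE `−e_μ`-EQUIVARIANT**: `x′ ↦ x′ − e_μ` maps the fibre of `x` bijectively onto the fibre of `x − e_μ`. [folklore] -/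
theorem unshift_fibre_bijective (x : Site P 0) (μ' : Fin P'.d) :
    Function.Bijective (fun x' : {x' : Site P' 0 // φ x' = x} =>
      (⟨x'.1.unshift μ', by rw [hu, x'.2]⟩ : {x' : Site P' 0 // φ x' = x.unshift (Fin.cast hd μ')})) :=
  Function.bijective_iff_has_inverse.mpr
    ⟨fun y' => ⟨y'.1.shift μ', by rw [hs, y'.2, Site.shift_unshift]⟩,
      fun x' => Subtype.ext (Site.shift_unshift x'.1 μ'), fun y' => Subtype.ext (Site.unshift_shift y'.1 μ')⟩

include hs hu in
/-- **… AND `+e_μ`-EQUIVARIANT**. [folklore] -/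
theorem shift_fibre_bijective (x : Site P 0) (μ' : Fin P'.d) :
    Function.Bijective (fun x' : {x' : Site P' 0 // φ x' = x} =>
      (⟨x'.1.shift μ', by rw [hs, x'.2]⟩ : {x' : Site P' 0 // φ x' = x.shift (Fin.cast hd μ')})) :=
  Function.bijective_iff_has_inverse.mpr
    ⟨fun y' => ⟨y'.1.unshift μ', by rw [hu, y'.2, Site.unshift_shift]⟩,
      fun x' => Subtype.ext (Site.unshift_shift x'.1 μ'), fun y' => Subtype.ext (Site.shift_unshift y'.1 μ')⟩

/-- the fibre of a BOND `⟨x, μ⟩` under `φB` is the fibre of the site `x` (the direction is forced): `b′ ↦ b′₋` is a bijection. [folklore] -/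
theorem bondFibre_src_bijective (x : Site P 0) (μ' : Fin P'.d) :
    Function.Bijective (fun b' : {b' : PBond P' 0 // (⟨φ b'.src, Fin.cast hd b'.dir⟩ : PBond P 0) = ⟨x, Fin.cast hd μ'⟩} =>
      (⟨b'.1.src, (by simpa only [PBond.mk.injEq] using b'.2 : φ b'.1.src = x ∧ Fin.cast hd b'.1.dir = Fin.cast hd μ').1⟩ :
        {x' : Site P' 0 // φ x' = x})) := by
  refine Function.bijective_iff_has_inverse.mpr ⟨fun x' => ⟨⟨x'.1, μ'⟩, by rw [x'.2]⟩, fun b' => ?_, fun x' => rfl⟩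
  obtain ⟨⟨s, d⟩, h⟩ := b'
  have h' : φ s = x ∧ Fin.cast hd d = Fin.cast hd μ' := by simpa only [PBond.mk.injEq] using h
  have hdμ : d = μ' := Fin.ext (by simpa using congrArg Fin.val h'.2)
  subst hdμ
  rfl

/-- **PUSHFORWARD OF A BOND FUNCTION, READ AT `⟨x, μ⟩`**: the fibre sum over bonds is the fibre sum over sites. [folklore] -/
theorem pushBond_apply (g : PBond P' 0 → ℝ) (x : Site P 0) (μ' : Fin P'.d) :
    ∑ b' : {b' : PBond P' 0 // (⟨φ b'.src, Fin.cast hd b'.dir⟩ : PBond P 0) = ⟨x, Fin.cast hd μ'⟩}, g b'.1 =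
      ∑ x' : {x' : Site P' 0 // φ x' = x}, g ⟨x'.1, μ'⟩ := by
  refine Fintype.sum_bijective _ (bondFibre_src_bijective hd φ x μ') (fun b' => g b'.1) (fun x' => g ⟨x'.1, μ'⟩) fun b' => ?_
  obtain ⟨⟨s, d⟩, h⟩ := b'
  have h' : φ s = x ∧ Fin.cast hd d = Fin.cast hd μ' := by simpa only [PBond.mk.injEq] using h
  have hdμ : d = μ' := Fin.ext (by simpa using congrArg Fin.val h'.2)
  subst hdμ
  rfl

include hs hu in
/-- **`∂` WITH THE PUSHFORWARD**: `∂(φ_* g)(⟨x, μ⟩) = Σ_{x′ : φ x′ = x} (∂g)(⟨x′, μ⟩)`. [cite: Balaban1984PropagatorsI, (1.4) p.18] -/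
theorem grad_push (c : ℝ) (g : Site P' 0 → ℝ) (x : Site P 0) (μ' : Fin P'.d) :
    grad c (fun y : Site P 0 => ∑ y' : {y' : Site P' 0 // φ y' = y}, g y'.1) ⟨x, Fin.cast hd μ'⟩ =
      ∑ x' : {x' : Site P' 0 // φ x' = x}, grad c g ⟨x'.1, μ'⟩ := by
  have e1 : ∑ y' : {y' : Site P' 0 // φ y' = x.shift (Fin.cast hd μ')}, g y'.1 = ∑ x' : {x' : Site P' 0 // φ x' = x}, g (x'.1.shift μ') :=
    (Fintype.sum_bijective _ (shift_fibre_bijective hd φ hs hu x μ') _ _ fun x' => rfl).symm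
  change c • ((∑ y' : {y' : Site P' 0 // φ y' = x.shift (Fin.cast hd μ')}, g y'.1) - ∑ y' : {y' : Site P' 0 // φ y' = x}, g y'.1) = _
  rw [e1, ← Finset.sum_sub_distrib, Finset.smul_sum]
  simp only [grad, PBond.tgt]

include hs hu in
/-- **`∂*` WITH THE PUSHFORWARD**: `∂*(φB_* g)(x) = Σ_{x′ : φ x′ = x} (∂*g)(x′)`. [cite: Balaban1984PropagatorsI, (1.21) p.21] -/
theorem diverg_push (c : ℝ) (g : PBond P' 0 → ℝ) (x : Site P 0) :
    diverg c (fun b : PBond P 0 => ∑ b' : {b' : PBond P' 0 // (⟨φ b'.src, Fin.cast hd b'.dir⟩ : PBond P 0) = b}, g b'.1) x =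
      ∑ x' : {x' : Site P' 0 // φ x' = x}, diverg c g x'.1 := by
  have key : ∀ μ' : Fin P'.d,
      c • ((∑ b' : {b' : PBond P' 0 // (⟨φ b'.src, Fin.cast hd b'.dir⟩ : PBond P 0) = ⟨x.unshift (Fin.cast hd μ'), Fin.cast hd μ'⟩}, g b'.1) -
        ∑ b' : {b' : PBond P' 0 // (⟨φ b'.src, Fin.cast hd b'.dir⟩ : PBond P 0) = ⟨x, Fin.cast hd μ'⟩}, g b'.1) =
      ∑ x' : {x' : Site P' 0 // φ x' = x}, c • (g ⟨x'.1.unshift μ', μ'⟩ - g ⟨x'.1, μ'⟩) := by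
    intro μ'
    have e1 : ∑ b' : {b' : PBond P' 0 // (⟨φ b'.src, Fin.cast hd b'.dir⟩ : PBond P 0) = ⟨x.unshift (Fin.cast hd μ'), Fin.cast hd μ'⟩}, g b'.1 =
        ∑ x' : {x' : Site P' 0 // φ x' = x}, g ⟨x'.1.unshift μ', μ'⟩ := by
      rw [pushBond_apply hd φ g (x.unshift (Fin.cast hd μ')) μ']
      exact (Fintype.sum_bijective _ (unshift_fibre_bijective hd φ hs hu x μ') _ _ fun x' => rfl).symm
    rw [e1, pushBond_apply hd φ g x μ', ← Finset.sum_sub_distrib, Finset.smul_sum]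
  have lhs : diverg c (fun b : PBond P 0 => ∑ b' : {b' : PBond P' 0 // (⟨φ b'.src, Fin.cast hd b'.dir⟩ : PBond P 0) = b}, g b'.1) x =
      ∑ μ' : Fin P'.d, ∑ x' : {x' : Site P' 0 // φ x' = x}, c • (g ⟨x'.1.unshift μ', μ'⟩ - g ⟨x'.1, μ'⟩) := by
    rw [← Fintype.sum_congr _ _ key]
    exact (Equiv.sum_comp (finCongr hd) (fun μ : Fin P.d => c • ((∑ b' : {b' : PBond P' 0 // (⟨φ b'.src, Fin.cast hd b'.dir⟩ : PBond P 0) =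
      ⟨x.unshift μ, μ⟩}, g b'.1) - ∑ b' : {b' : PBond P' 0 // (⟨φ b'.src, Fin.cast hd b'.dir⟩ : PBond P 0) = ⟨x, μ⟩}, g b'.1))).symm
  rw [lhs, Finset.sum_comm]
  rfl

include hs hu in
/-- **`Δ` WITH THE PUSHFORWARD**: `Δ(φ_* g)(x) = Σ_{x′ : φ x′ = x} (Δg)(x′)`. [cite: Balaban1984PropagatorsI, (1.21) p.21] -/
theorem laplace_push (c : ℝ) (g : Site P' 0 → ℝ) (x : Site P 0) :
    laplace c (fun y : Site P 0 => ∑ y' : {y' : Site P' 0 // φ y' = y}, g y'.1) x =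
      ∑ x' : {x' : Site P' 0 // φ x' = x}, laplace c g x'.1 := by
  have key : ∀ μ' : Fin P'.d,
      (c ^ 2) • ((∑ y' : {y' : Site P' 0 // φ y' = x}, g y'.1) + (∑ y' : {y' : Site P' 0 // φ y' = x}, g y'.1) -
        (∑ y' : {y' : Site P' 0 // φ y' = x.shift (Fin.cast hd μ')}, g y'.1) - ∑ y' : {y' : Site P' 0 // φ y' = x.unshift (Fin.cast hd μ')}, g y'.1) =
      ∑ x' : {x' : Site P' 0 // φ x' = x}, (c ^ 2) • (g x'.1 + g x'.1 - g (x'.1.shift μ') - g (x'.1.unshift μ')) := by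
    intro μ'
    have e1 : ∑ y' : {y' : Site P' 0 // φ y' = x.shift (Fin.cast hd μ')}, g y'.1 = ∑ x' : {x' : Site P' 0 // φ x' = x}, g (x'.1.shift μ') :=
      (Fintype.sum_bijective _ (shift_fibre_bijective hd φ hs hu x μ') _ _ fun x' => rfl).symm
    have e2 : ∑ y' : {y' : Site P' 0 // φ y' = x.unshift (Fin.cast hd μ')}, g y'.1 = ∑ x' : {x' : Site P' 0 // φ x' = x}, g (x'.1.unshift μ') :=
      (Fintype.sum_bijective _ (unshift_fibre_bijective hd φ hs hu x μ') _ _ fun x' => rfl).symm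
    rw [e1, e2, ← Finset.sum_add_distrib, ← Finset.sum_sub_distrib, ← Finset.sum_sub_distrib, Finset.smul_sum]
  have lhs : laplace c (fun y : Site P 0 => ∑ y' : {y' : Site P' 0 // φ y' = y}, g y'.1) x =
      ∑ μ' : Fin P'.d, ∑ x' : {x' : Site P' 0 // φ x' = x}, (c ^ 2) • (g x'.1 + g x'.1 - g (x'.1.shift μ') - g (x'.1.unshift μ')) := by
    rw [← Fintype.sum_congr _ _ key]
    exact (Equiv.sum_comp (finCongr hd) (fun μ : Fin P.d => (c ^ 2) • ((∑ y' : {y' : Site P' 0 // φ y' = x}, g y'.1) +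
      (∑ y' : {y' : Site P' 0 // φ y' = x}, g y'.1) - (∑ y' : {y' : Site P' 0 // φ y' = x.shift μ}, g y'.1) -
      ∑ y' : {y' : Site P' 0 // φ y' = x.unshift μ}, g y'.1))).symm
  rw [lhs, Finset.sum_comm]
  rfl

/-- the fibre of a PLAQUETTE under `φP` is the fibre of its base site: `p′ ↦ p′₀` is a bijection. [folklore] -/
theorem plaqFibre_src_bijective (x : Site P 0) (μ' ν' : Fin P'.d) (h : μ' < ν') :
    Function.Bijective (fun p' : {p' : Plaq P' 0 // (⟨φ p'.src, Fin.cast hd p'.μ, Fin.cast hd p'.ν, Fin.lt_def.mpr (Fin.lt_def.mp p'.hμν)⟩ : Plaq P 0) =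
        ⟨x, Fin.cast hd μ', Fin.cast hd ν', Fin.lt_def.mpr (Fin.lt_def.mp h)⟩} =>
      (⟨p'.1.src, (by simpa only [Plaq.mk.injEq] using p'.2 :
          φ p'.1.src = x ∧ Fin.cast hd p'.1.μ = Fin.cast hd μ' ∧ Fin.cast hd p'.1.ν = Fin.cast hd ν').1⟩ : {x' : Site P' 0 // φ x' = x})) := by
  refine Function.bijective_iff_has_inverse.mpr ⟨fun x' => ⟨⟨x'.1, μ', ν', h⟩, by simp only [x'.2]⟩, fun p' => ?_, fun x' => rfl⟩
  obtain ⟨⟨s, a, b, hab⟩, hh⟩ := p'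
  have hh' : φ s = x ∧ Fin.cast hd a = Fin.cast hd μ' ∧ Fin.cast hd b = Fin.cast hd ν' := by simpa only [Plaq.mk.injEq] using hh
  have ha : a = μ' := Fin.ext (by simpa using congrArg Fin.val hh'.2.1)
  have hb : b = ν' := Fin.ext (by simpa using congrArg Fin.val hh'.2.2)
  subst ha; subst hb
  rfl

include hs hu in
/-- **curl WITH THE PUSHFORWARD**: `curl(φB_* g)(p) = Σ_{p′ : φP p′ = p} (curl g)(p′)`, read at `p = ⟨x, μ, ν⟩`. [cite: Balaban1984PropagatorsI, (1.2) p.18] -/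
theorem curl_push (c : ℝ) (g : PBond P' 0 → ℝ) (x : Site P 0) (μ' ν' : Fin P'.d) (h : μ' < ν') :
    curl c (fun b : PBond P 0 => ∑ b' : {b' : PBond P' 0 // (⟨φ b'.src, Fin.cast hd b'.dir⟩ : PBond P 0) = b}, g b'.1)
        ⟨x, Fin.cast hd μ', Fin.cast hd ν', Fin.lt_def.mpr (Fin.lt_def.mp h)⟩ =
      ∑ p' : {p' : Plaq P' 0 // (⟨φ p'.src, Fin.cast hd p'.μ, Fin.cast hd p'.ν, Fin.lt_def.mpr (Fin.lt_def.mp p'.hμν)⟩ : Plaq P 0) =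
        ⟨x, Fin.cast hd μ', Fin.cast hd ν', Fin.lt_def.mpr (Fin.lt_def.mp h)⟩}, curl c g p'.1 := by
  have er : ∑ p' : {p' : Plaq P' 0 // (⟨φ p'.src, Fin.cast hd p'.μ, Fin.cast hd p'.ν, Fin.lt_def.mpr (Fin.lt_def.mp p'.hμν)⟩ : Plaq P 0) =
        ⟨x, Fin.cast hd μ', Fin.cast hd ν', Fin.lt_def.mpr (Fin.lt_def.mp h)⟩}, curl c g p'.1 =
      ∑ x' : {x' : Site P' 0 // φ x' = x}, curl c g ⟨x'.1, μ', ν', h⟩ := by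
    refine Fintype.sum_bijective _ (plaqFibre_src_bijective hd φ x μ' ν' h) (fun p' => curl c g p'.1) (fun x' => curl c g ⟨x'.1, μ', ν', h⟩) fun p' => ?_
    obtain ⟨⟨s, a, b, hab⟩, hh⟩ := p'
    have hh' : φ s = x ∧ Fin.cast hd a = Fin.cast hd μ' ∧ Fin.cast hd b = Fin.cast hd ν' := by simpa only [Plaq.mk.injEq] using hh
    have ha : a = μ' := Fin.ext (by simpa using congrArg Fin.val hh'.2.1)
    have hb : b = ν' := Fin.ext (by simpa using congrArg Fin.val hh'.2.2)
    subst ha; subst hb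
    rfl
  rw [er]
  simp only [curl]
  have eμ : ∑ b' : {b' : PBond P' 0 // (⟨φ b'.src, Fin.cast hd b'.dir⟩ : PBond P 0) = ⟨x.shift (Fin.cast hd μ'), Fin.cast hd ν'⟩}, g b'.1 =
      ∑ x' : {x' : Site P' 0 // φ x' = x}, g ⟨x'.1.shift μ', ν'⟩ := by
    rw [pushBond_apply hd φ g (x.shift (Fin.cast hd μ')) ν']
    exact (Fintype.sum_bijective _ (shift_fibre_bijective hd φ hs hu x μ') _ _ fun x' => rfl).symm
  have eν : ∑ b' : {b' : PBond P' 0 // (⟨φ b'.src, Fin.cast hd b'.dir⟩ : PBond P 0) = ⟨x.shift (Fin.cast hd ν'), Fin.cast hd μ'⟩}, g b'.1 =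
      ∑ x' : {x' : Site P' 0 // φ x' = x}, g ⟨x'.1.shift ν', μ'⟩ := by
    rw [pushBond_apply hd φ g (x.shift (Fin.cast hd ν')) μ']
    exact (Fintype.sum_bijective _ (shift_fibre_bijective hd φ hs hu x ν') _ _ fun x' => rfl).symm
  rw [pushBond_apply hd φ g x μ', pushBond_apply hd φ g x ν', eμ, eν, ← Finset.sum_add_distrib, ← Finset.sum_sub_distrib, ← Finset.sum_sub_distrib,
    Finset.smul_sum]

end Summit.QuantumFields.YangMills.Theorems.CoverStencils

end
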